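import Mathlib.MeasureTheory.Measure.Portmanteau
import Mathlib.MeasureTheory.Integral.Bochner.Basic
import Mathlib.Topology.Metrizable.Uniformity
import HarnessLib

/-!
# Joint limits in law `(X_k, v_k) ⇒ (S, w S)` from two-sided approximation

Topic `Literature/Probability/Distributions`; glue of weak-convergence bookkeeping in the setting
of `JointLawClosedConstraint.lean` / `JointLawSubseqLimit.lean` (random elements `X_k` of a
pseudo-metrisable Borel space `E` together with random elements `v_k` of a metric space `V`, and
joint limits in law supported on a GRAPH `{(S, w S)}`, stated in the functional form
`∫ G(X_k, v_k) dP → ∫ G(S, w S) dμ` for bounded continuous `G`), written for the extension of the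
Garban–Pete–Schramm joint limit of a lattice configuration with its pivotal measures from
countably many test functions / cutoffs to all of them (route
`Summits/CriticalPhenomena/CardyFormulaZ2/Theses/CardyMeckeFlip`, crux `FlipErgodicityZ2`, stub
`stub_jointKernelLimit`), but model-free.

**Result** (`tendsto_pair_of_approx`, Billingsley's "approximation in probability, uniformly in
`k`" theorem in graph form).  Suppose that for every `n` the approximants `(X_k, v⁽ⁿ⁾_k)` converge
jointly in law to `(S, w⁽ⁿ⁾ S)`, `S ∼ μ`, that `E[min 1 (dist (v_k, v⁽ⁿ⁾_k))] ≤ b_n + η` for all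
large `k` (every `η > 0`), and `∫ min 1 (dist (w S, w⁽ⁿ⁾ S)) dμ ≤ b_n`, with `b_n → 0`.  Then
`(X_k, v_k)` converges jointly in law to `(S, w S)`.  Proof: by the portmanteau theorem it is
enough to test bounded Lipschitz `f` on `E × V` (Mathlib's
`tendsto_iff_forall_lipschitz_integral_tendsto`, for the laws as `ProbabilityMeasure`s); for such
`f`, `|f(x, y) - f(x, y')| ≤ K min 1 (dist (y, y'))`, and a `3ε`-argument concludes.

No named fact, no definition; Mathlib only.

## References

* P. Billingsley, *Convergence of Probability Measures*, 2nd ed. (1999), Thm. 3.2 (convergence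
  of approximants uniformly close in probability) and Thm. 2.1 (portmanteau).
-/

noncomputable section

open Set Filter Metric
open _root_.MeasureTheory _root_.Topology _root_.TopologicalSpace
open scoped NNReal BoundedContinuousFunction

namespace Literature.Probability.Distributions

section Pointwise

variable {E V : Type*} [PseudoMetricSpace E] [PseudoMetricSpace V]

/-- A bounded Lipschitz function on a product metric space is, in the second variable, Lipschitz
for the bounded metric `min 1 dist`: `|f (x, y) - f (x, y')| ≤ max C L * min 1 (dist y y')`.
[folklore] -/
theorem abs_sub_le_mul_min_one_dist {f : E × V → ℝ} {C : ℝ} {L : ℝ≥0}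
    (hC : ∀ z z', dist (f z) (f z') ≤ C) (hL : LipschitzWith L f) (x : E) (y y' : V) :
    |f (x, y) - f (x, y')| ≤ max C L * min 1 (dist y y') := by
  have h1 : |f (x, y) - f (x, y')| ≤ C := by rw [← Real.dist_eq]; exact hC _ _
  have h2 : |f (x, y) - f (x, y')| ≤ L * dist y y' := by
    rw [← Real.dist_eq]
    refine (hL.dist_le_mul _ _).trans (le_of_eq ?_)
    rw [Prod.dist_eq, dist_self, max_eq_right dist_nonneg]
  rcases le_total 1 (dist y y') with hd | hd
  · rw [min_eq_left hd, mul_one]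
    exact h1.trans (le_max_left _ _)
  · rw [min_eq_right hd]
    exact h2.trans (mul_le_mul_of_nonneg_right (le_max_right _ _) dist_nonneg)

end Pointwise

section Approx

variable {Ω E V : Type*} [MeasurableSpace Ω] {P : Measure Ω} [IsProbabilityMeasure P]
  [TopologicalSpace E] [PseudoMetrizableSpace E] [MeasurableSpace E] [OpensMeasurableSpace E]
  {μ : Measure E} [IsProbabilityMeasure μ]
  [PseudoMetricSpace V] [SecondCountableTopology V] [MeasurableSpace V] [OpensMeasurableSpace V]

omit [IsProbabilityMeasure P] [PseudoMetrizableSpace E] [IsProbabilityMeasure μ] in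
/-- `ω ↦ min 1 (dist (u ω) (u' ω))` is integrable against a finite measure for measurable
`u, u'`. [folklore] -/
theorem integrable_min_one_dist {ν : Measure Ω} [IsFiniteMeasure ν] {u u' : Ω → V}
    (hu : Measurable u) (hu' : Measurable u') :
    Integrable (fun ω => min 1 (dist (u ω) (u' ω))) ν := by
  refine Integrable.of_bound ((measurable_const.min (hu.dist hu')).aestronglyMeasurable) 1
    (ae_of_all _ fun ω => ?_)
  rw [Real.norm_eq_abs, abs_of_nonneg (le_min zero_le_one dist_nonneg)]
  exact min_le_left _ _

/-- **Joint limits in law from two-sided approximation** (graph form of Billingsley's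
Thm. 3.2).  Let `X_k : Ω → E` (`E` pseudo-metrisable Borel), `v_k : Ω → V` (`V` separable
metric) be measurable, `w : E → V` measurable, and for every `n` let measurable approximants
`v⁽ⁿ⁾_k`, `w⁽ⁿ⁾` satisfy: `(X_k, v⁽ⁿ⁾_k) ⇒ (S, w⁽ⁿ⁾ S)` jointly (bounded continuous test
functions of `E × V`, `S ∼ μ`); for every `η > 0`, `E[min 1 (dist (v_k, v⁽ⁿ⁾_k))] ≤ b_n + η`
for all large `k`; and `∫ min 1 (dist (w S, w⁽ⁿ⁾ S)) dμ ≤ b_n`, where `b_n → 0`.  Then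
`(X_k, v_k) ⇒ (S, w S)` jointly. [folklore] -/
theorem tendsto_pair_of_approx {X : ℕ → Ω → E} (hX : ∀ k, Measurable (X k))
    {v : ℕ → Ω → V} (hv : ∀ k, Measurable (v k)) {w : E → V} (hw : Measurable w)
    {va : ℕ → ℕ → Ω → V} (hva : ∀ n k, Measurable (va n k))
    {wa : ℕ → E → V} (hwa : ∀ n, Measurable (wa n))
    (hconv : ∀ n, ∀ G : (E × V) →ᵇ ℝ,
      Tendsto (fun k => ∫ ω, G (X k ω, va n k ω) ∂P) atTop (𝓝 (∫ S, G (S, wa n S) ∂μ)))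
    {b : ℕ → ℝ} (hb : Tendsto b atTop (𝓝 0))
    (hv_approx : ∀ n, ∀ η : ℝ, 0 < η → ∀ᶠ k in atTop,
      ∫ ω, min 1 (dist (v k ω) (va n k ω)) ∂P ≤ b n + η)
    (hw_approx : ∀ n, ∫ S, min 1 (dist (w S) (wa n S)) ∂μ ≤ b n)
    (F : (E × V) →ᵇ ℝ) :
    Tendsto (fun k => ∫ ω, F (X k ω, v k ω) ∂P) atTop (𝓝 (∫ S, F (S, w S) ∂μ)) := by
  letI : PseudoMetricSpace E := pseudoMetrizableSpacePseudoMetric E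
  -- measurability of the pairs
  have hXv : ∀ k, Measurable fun ω => (X k ω, v k ω) := fun k => (hX k).prodMk (hv k)
  have hXva : ∀ n k, Measurable fun ω => (X k ω, va n k ω) := fun n k => (hX k).prodMk (hva n k)
  have hSw : Measurable fun S : E => (S, w S) := measurable_id.prodMk hw
  have hSwa : ∀ n, Measurable fun S : E => (S, wa n S) := fun n => measurable_id.prodMk (hwa n)
  -- the laws
  set ρ : ℕ → ProbabilityMeasure (E × V) := fun k =>
    ⟨P.map fun ω => (X k ω, v k ω), Measure.isProbabilityMeasure_map (hXv k).aemeasurable⟩ with hρ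
  set ρlim : ProbabilityMeasure (E × V) :=
    ⟨μ.map fun S => (S, w S), Measure.isProbabilityMeasure_map hSw.aemeasurable⟩ with hρlim
  suffices h : Tendsto ρ atTop (𝓝 ρlim) by
    have hF := (ProbabilityMeasure.tendsto_iff_forall_integral_tendsto.1 h) F
    simp only [hρ, hρlim, ProbabilityMeasure.coe_mk] at hF
    rw [integral_map hSw.aemeasurable F.continuous.aestronglyMeasurable] at hF
    refine hF.congr fun k => ?_
    rw [integral_map (hXv k).aemeasurable F.continuous.aestronglyMeasurable]
  rw [tendsto_iff_forall_lipschitz_integral_tendsto]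
  rintro f ⟨C, hC⟩ ⟨L, hL⟩
  -- `f` as a bounded continuous function, and the integrals on `Ω` / `E`
  set fb : (E × V) →ᵇ ℝ := BoundedContinuousFunction.mkOfBound ⟨f, hL.continuous⟩ C hC with hfb
  have hfbf : ∀ z, fb z = f z := fun z => rfl
  have hfiP : ∀ {g : Ω → E × V}, Measurable g → Integrable (fun ω => f (g ω)) P := fun {g} hg =>
    Integrable.of_bound (fb.continuous.measurable.comp hg).aestronglyMeasurable ‖fb‖
      (ae_of_all _ fun y => fb.norm_coe_le_norm (g y))
  have hfiμ : ∀ {g : E → E × V}, Measurable g → Integrable (fun S => f (g S)) μ := fun {g} hg =>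
    Integrable.of_bound (fb.continuous.measurable.comp hg).aestronglyMeasurable ‖fb‖
      (ae_of_all _ fun y => fb.norm_coe_le_norm (g y))
  simp only [hρ, hρlim, ProbabilityMeasure.coe_mk]
  rw [integral_map hSw.aemeasurable hL.continuous.aestronglyMeasurable]
  have e1 : (fun k => ∫ z, f z ∂(P.map fun ω => (X k ω, v k ω))) =
      fun k => ∫ ω, f (X k ω, v k ω) ∂P :=
    funext fun k => integral_map (hXv k).aemeasurable hL.continuous.aestronglyMeasurable
  rw [e1]
  -- the key pointwise estimate
  set K : ℝ := max C L with hK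
  have hK0 : 0 ≤ K := le_max_of_le_right L.coe_nonneg
  have key : ∀ (x : E) (y y' : V), |f (x, y) - f (x, y')| ≤ K * min 1 (dist y y') :=
    abs_sub_le_mul_min_one_dist hC hL
  -- (a) the lattice-side approximation error
  have ha : ∀ n k, |∫ ω, f (X k ω, v k ω) ∂P - ∫ ω, f (X k ω, va n k ω) ∂P| ≤
      K * ∫ ω, min 1 (dist (v k ω) (va n k ω)) ∂P := fun n k => by
    rw [← integral_sub (hfiP (hXv k)) (hfiP (hXva n k)), ← integral_const_mul]
    refine abs_integral_le_integral_abs.trans (integral_mono ((hfiP (hXv k)).sub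
      (hfiP (hXva n k))).abs ((integrable_min_one_dist (hv k) (hva n k)).const_mul K)
      fun ω => key _ _ _)
  -- (c) the limit-side approximation error
  have hc : ∀ n, |∫ S, f (S, wa n S) ∂μ - ∫ S, f (S, w S) ∂μ| ≤ K * b n := fun n => by
    rw [← integral_sub (hfiμ (hSwa n)) (hfiμ hSw)]
    calc |∫ S, f (S, wa n S) - f (S, w S) ∂μ|
        ≤ ∫ S, K * min 1 (dist (w S) (wa n S)) ∂μ := by
          refine abs_integral_le_integral_abs.trans (integral_mono ((hfiμ (hSwa n)).sub
            (hfiμ hSw)).abs ((integrable_min_one_dist hw (hwa n)).const_mul K) fun S => ?_)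
          rw [dist_comm]
          exact key _ _ _
      _ = K * ∫ S, min 1 (dist (w S) (wa n S)) ∂μ := integral_const_mul _ _
      _ ≤ K * b n := mul_le_mul_of_nonneg_left (hw_approx n) hK0
  -- the `3ε`-argument
  refine Metric.tendsto_nhds.2 fun ε hε => ?_
  have hKb : Tendsto (fun n => K * b n) atTop (𝓝 0) := by simpa using hb.const_mul K
  obtain ⟨n, hn⟩ : ∃ n, K * b n < ε / 4 :=
    (hKb.eventually (eventually_lt_nhds (by positivity : (0 : ℝ) < ε / 4))).exists
  have hη : 0 < ε / (4 * (K + 1)) := by positivity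
  have hKη : K * (ε / (4 * (K + 1))) < ε / 4 := by
    have e : K * (ε / (4 * (K + 1))) = ε / 4 * (K / (K + 1)) := by
      field_simp
    rw [e]
    exact mul_lt_of_lt_one_right (by positivity) ((div_lt_one (by positivity)).2 (by linarith))
  have hb' := (hconv n fb).eventually (Metric.ball_mem_nhds _ (by positivity : (0 : ℝ) < ε / 4))
  filter_upwards [hv_approx n _ hη, hb'] with k hk hk'
  have hk'' : |∫ ω, f (X k ω, va n k ω) ∂P - ∫ S, f (S, wa n S) ∂μ| < ε / 4 := by
    have := Metric.mem_ball.1 hk'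
    rwa [Real.dist_eq] at this
  rw [Real.dist_eq]
  have h1 := ha n k
  have h2 := hc n
  have h3 : K * ∫ ω, min 1 (dist (v k ω) (va n k ω)) ∂P ≤ K * (b n + ε / (4 * (K + 1))) :=
    mul_le_mul_of_nonneg_left hk hK0
  calc |∫ ω, f (X k ω, v k ω) ∂P - ∫ S, f (S, w S) ∂μ|
      ≤ |∫ ω, f (X k ω, v k ω) ∂P - ∫ ω, f (X k ω, va n k ω) ∂P| +
          |∫ ω, f (X k ω, va n k ω) ∂P - ∫ S, f (S, w S) ∂μ| := abs_sub_le _ _ _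
    _ ≤ |∫ ω, f (X k ω, v k ω) ∂P - ∫ ω, f (X k ω, va n k ω) ∂P| +
          (|∫ ω, f (X k ω, va n k ω) ∂P - ∫ S, f (S, wa n S) ∂μ| +
            |∫ S, f (S, wa n S) ∂μ - ∫ S, f (S, w S) ∂μ|) := by
        gcongr
        exact abs_sub_le _ _ _
    _ < ε := by nlinarith

end Approx

end Literature.Probability.Distributions

end
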